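import Literature.MathematicalPhysics.KineticTheory.LangevinChainConfined
import Literature.MathematicalPhysics.KineticTheory.LangevinChainExpBound
import Literature.Probability.Process.BrownianSupTail
import Mathlib.MeasureTheory.Integral.MeanInequalities
import HarnessLib

/-!
# CEHR Remark 5.2 (H2) for a chain with confining potentials: the probabilistic shell around a pathwise energy drop

Topic `Literature/MathematicalPhysics/KineticTheory`. Cuneo–Eckmann–Hairer–Rey-Bellet,
*Non-equilibrium steady states for networks of oscillators*, EJP **23** (2018) no. 55, §5, Thm 5.1
/ Remark 5.2 (the Lyapunov condition H2, `E_z e^{θH(z_{t*})} ≤ κ e^{θH(z)} + c 1_K(z)`).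
`LangevinChainH2.lean` proved, for the transition kernels of ONE model (the pinned chain,
`OscillatorChain.transitionKernel` of `LangevinChainKernel.lean`), an Itô-free probabilistic
shell reducing H2 to a PATHWISE energy drop at high energy on the event that the bath Brownian
motions stay small over a short window. This file is the MODEL-FREE version (same proofs), for the
transition kernels `OscillatorChain.langevinKernel` of every chain with confining potentials
(`OscillatorChain.IsConfining`, `LangevinChainConfined.lean`: the law of the pathwise solution map
`langevinSolMap` under the pair of Wiener measures), smooth potentials, `N ≥ 1`, `T_L, T_R > 0`:

* `IsConfining.lintegral_exp_mul_hamiltonian_langevinKernel_le` — the a-priori bound (3.4)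
  `∫ e^{θH} dP_t(z,·) ≤ e^{θγ(T_L+T_R)t} e^{θH(z)}` for the constructed kernels
  (`LangevinChainExpBound.lean` for the interface object `IsConfining.semigroup`);
* `IsConfining.H2_of_decay` — **Remark 5.2**: a uniform decay `P_{t*} e^{θH}(z) ≤ e^{θH(z)}/2`
  above an energy `E₁` gives H2 in the form `P_{t*} e^{θH} ≤ e^{θH}/2 + c`,
  `c = e^{θγ(T_L+T_R)t*} e^{θE₁}` ((3.4) below `E₁`);
* `IsConfining.decay_of_window` — **reduction to one short window** `w ≤ t*` (Chapman–Kolmogorov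
  and (3.4) on the remaining time; in place of the iteration over stopping times of Cor. 5.4 —
  cf. Remark 5.7, Carmona 2007);
* `IsConfining.window_decay_of_pathwise` — **the window estimate from a pathwise energy drop**
  (in place of Lemma 5.5): if on `goodEvent a w = {sup_{s≤w}|B^{1,2}_s| ≤ a}` the solution started
  at `z` satisfies `θH(Φ_w(z,B)) ≤ θH(z) - D`, then
  `P_w e^{θH}(z) ≤ e^{θH(z)} (e^{-D} + e^{θγ(T_L+T_R)w} P(goodEventᶜ)^{1-1/p})` for `p > 1` with
  `pθ < 1/max(T_L,T_R)` (split the expectation; Hölder and (3.4) at `pθ` on the bad event).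

Everything is PROVED; no definition, no named fact. Consumed by the provefact unit of
`CuneoEckmannHairerReyBellet2018_pureQuarticChain` (`PureQuarticChainSemigroup.lean` reduces that
fact to H2 at `t* = 1` for `(pureQuarticChain μ γ).langevinKernel`).

## References

* N. Cuneo, J.-P. Eckmann, M. Hairer, L. Rey-Bellet, EJP **23** (2018) no. 55 (arXiv:1712.09413),
  §3 eq. (3.4), §5 Thm 5.1, Rem 5.2, Cor 5.4, Lemma 5.5, Rem 5.7.
* P. Carmona, Stoch. Proc. Appl. **117** (2007) 1076–1092.
-/

noncomputable section

open MeasureTheory ProbabilityTheory Filter Topology Set Metric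
open scoped NNReal ENNReal ContDiff

namespace Literature.MathematicalPhysics.KineticTheory.HeatConduction

open Literature.Probability.Process

namespace OscillatorChain.IsConfining

variable {P : OscillatorChain} {N : ℕ} {T_L T_R : ℝ}

/-- **(3.4) for the constructed kernels of a chain with confining potentials**: for smooth
potentials, `N ≥ 1`, `T_L, T_R > 0` and `0 < θ < 1/max(T_L,T_R)`,
`∫ e^{θH} dP_t(z, ·) ≤ e^{θγ(T_L+T_R)t} e^{θH(z)}` (Lebesgue integral).
[cite: CuneoEckmannHairerReyBellet2018, §3 eq. (3.4)] -/
theorem lintegral_exp_mul_hamiltonian_langevinKernel_le (hP : P.IsConfining) (hU : ContDiff ℝ ∞ P.U)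
    (hV : ContDiff ℝ ∞ P.V) (hN : 0 < N) (hTL : 0 < T_L) (hTR : 0 < T_R) {θ : ℝ} (hθ : 0 < θ)
    (hθ' : θ < 1 / max T_L T_R) (t : ℝ≥0) (z : PhaseSpace N) :
    ∫⁻ y, ENNReal.ofReal (Real.exp (θ * P.hamiltonian N y)) ∂(P.langevinKernel N T_L T_R t z) ≤
      ENNReal.ofReal (Real.exp (θ * P.γ * (T_L + T_R) * t) *
        Real.exp (θ * P.hamiltonian N z)) := by
  have hm : 0 < max T_L T_R := lt_max_of_lt_left hTL
  have hθm : θ * max T_L T_R ≤ 1 := ((lt_div_iff₀ hm).1 hθ').le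
  have hL : θ * T_L ≤ 1 := (mul_le_mul_of_nonneg_left (le_max_left _ _) hθ.le).trans hθm
  have hR : θ * T_R ≤ 1 := (mul_le_mul_of_nonneg_left (le_max_right _ _) hθ.le).trans hθm
  have h := (hP.semigroup N T_L T_R hN hTL.le hTR.le).lintegral_exp_mul_hamiltonian_le hU hV hN
    hP.γ_nonneg hTL.le hTR.le (hP.isCompact_setOf_hamiltonian_le N) hθ.le hL hR t z
  rwa [semigroup_kernel] at h

/-- **Remark 5.2 of CEHR for the constructed kernels of a chain with confining potentials**: a
uniform decay `P_{t*} e^{θH}(z) ≤ e^{θH(z)}/2` above the energy `E₁` gives the Lyapunov condition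
H2 in the form `P_{t*} e^{θH}(z) ≤ κ e^{θH(z)} + c` for all `z`, with `κ = 1/2` and
`c = e^{θγ(T_L+T_R)t*} e^{θE₁}` (below `E₁` the a-priori bound (3.4) applies; the printed compact
set `K = {H ≤ E₁}` is absorbed in the constant). [cite: CuneoEckmannHairerReyBellet2018, Rem 5.2] -/
theorem H2_of_decay (hP : P.IsConfining) (hU : ContDiff ℝ ∞ P.U)
    (hV : ContDiff ℝ ∞ P.V) (hN : 0 < N) (hTL : 0 < T_L) (hTR : 0 < T_R) {θ : ℝ} (hθ : 0 < θ) (hθ' : θ < 1 / max T_L T_R) (tstar : ℝ≥0) {E₁ : ℝ}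
    (hdecay : ∀ z : PhaseSpace N, E₁ ≤ P.hamiltonian N z →
      ∫⁻ y, ENNReal.ofReal (Real.exp (θ * P.hamiltonian N y))
          ∂(P.langevinKernel N T_L T_R tstar z) ≤
        ENNReal.ofReal (Real.exp (θ * P.hamiltonian N z) / 2)) :
    ∃ κ c : ℝ, 0 ≤ κ ∧ κ < 1 ∧ 0 ≤ c ∧
      ∀ z : PhaseSpace N,
        ∫⁻ y, ENNReal.ofReal (Real.exp (θ * P.hamiltonian N y))
            ∂(P.langevinKernel N T_L T_R tstar z) ≤
          ENNReal.ofReal (κ * Real.exp (θ * P.hamiltonian N z) + c) := by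
  set H := P.hamiltonian N with hH
  set c := Real.exp (θ * P.γ * (T_L + T_R) * tstar) * Real.exp (θ * E₁) with hc
  have hcpos : 0 < c := by positivity
  refine ⟨1 / 2, c, by norm_num, by norm_num, hcpos.le, fun z => ?_⟩
  by_cases hz : E₁ ≤ H z
  · refine (hdecay z hz).trans (ENNReal.ofReal_le_ofReal ?_)
    linarith
  · refine (hP.lintegral_exp_mul_hamiltonian_langevinKernel_le hU hV hN hTL hTR hθ hθ' tstar
      z).trans (ENNReal.ofReal_le_ofReal ?_)
    have h1 : Real.exp (θ * H z) ≤ Real.exp (θ * E₁) :=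
      Real.exp_le_exp.2 (mul_le_mul_of_nonneg_left (le_of_lt (not_le.1 hz)) hθ.le)
    have h2 : Real.exp (θ * P.γ * (T_L + T_R) * tstar) * Real.exp (θ * H z) ≤ c :=
      mul_le_mul_of_nonneg_left h1 (Real.exp_pos _).le
    have h3 : 0 ≤ 1 / 2 * Real.exp (θ * H z) := by positivity
    linarith

/-- **Reduction of the decay over `[0, t*]` to one window `w ≤ t*`** (in place of CEHR Cor. 5.4):
if from every `z` with `H(z) ≥ E₁` some window `w ≤ t*` has `P_w e^{θH}(z) ≤ κ₀ e^{θH(z)}` and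
`κ₀ e^{θγ(T_L+T_R)t*} ≤ 1/2`, then `P_{t*} e^{θH}(z) ≤ e^{θH(z)}/2` for `H(z) ≥ E₁`
(`P_{t*} = P_{t*-w} ∘ P_w`, Chapman–Kolmogorov, and (3.4) on the remaining time).
[cite: CuneoEckmannHairerReyBellet2018, Cor 5.4 and Rem 5.7] -/
theorem decay_of_window (hP : P.IsConfining) (hU : ContDiff ℝ ∞ P.U)
    (hV : ContDiff ℝ ∞ P.V) (hN : 0 < N) (hTL : 0 < T_L) (hTR : 0 < T_R) {θ : ℝ} (hθ : 0 < θ) (hθ' : θ < 1 / max T_L T_R) (tstar : ℝ≥0)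
    {E₁ κ₀ : ℝ} (hκ : κ₀ * Real.exp (θ * P.γ * (T_L + T_R) * tstar) ≤ 1 / 2)
    (hwin : ∀ z : PhaseSpace N, E₁ ≤ P.hamiltonian N z →
      ∃ w : ℝ≥0, w ≤ tstar ∧
        ∫⁻ y, ENNReal.ofReal (Real.exp (θ * P.hamiltonian N y))
            ∂(P.langevinKernel N T_L T_R w z) ≤
          ENNReal.ofReal (κ₀ * Real.exp (θ * P.hamiltonian N z)))
    (z : PhaseSpace N) (hz : E₁ ≤ P.hamiltonian N z) :
    ∫⁻ y, ENNReal.ofReal (Real.exp (θ * P.hamiltonian N y))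
        ∂(P.langevinKernel N T_L T_R tstar z) ≤
      ENNReal.ofReal (Real.exp (θ * P.hamiltonian N z) / 2) := by
  set H := P.hamiltonian N with hH
  set κ := P.langevinKernel N T_L T_R with hκ'
  obtain ⟨w, hw, hb⟩ := hwin z hz
  set s : ℝ≥0 := tstar - w with hs
  have hts : tstar = w + s := (add_tsub_cancel_of_le hw).symm
  have hsle : (s : ℝ) ≤ tstar := by
    have : s ≤ tstar := tsub_le_self
    exact_mod_cast this
  have hVm : Measurable fun y : PhaseSpace N => ENNReal.ofReal (Real.exp (θ * H y)) :=
    ENNReal.measurable_ofReal.comp (Real.measurable_exp.comp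
      (measurable_const.mul (hP.differentiable_hamiltonian N).continuous.measurable))
  have hγ0 : 0 ≤ P.γ := hP.γ_nonneg
  -- Chapman–Kolmogorov
  have e1 : ∫⁻ y, ENNReal.ofReal (Real.exp (θ * H y)) ∂(κ tstar z) =
      ∫⁻ y, ∫⁻ y', ENNReal.ofReal (Real.exp (θ * H y')) ∂(κ s y) ∂(κ w z) := by
    rw [hts, hκ', hP.langevinKernel_add N T_L T_R w s]
    exact Kernel.lintegral_comp _ _ _ hVm
  -- (3.4) on the remaining time `s = t* - w`
  have e2 : ∀ y, ∫⁻ y', ENNReal.ofReal (Real.exp (θ * H y')) ∂(κ s y) ≤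
      ENNReal.ofReal (Real.exp (θ * P.γ * (T_L + T_R) * tstar)) *
        ENNReal.ofReal (Real.exp (θ * H y)) := by
    intro y
    refine (hP.lintegral_exp_mul_hamiltonian_langevinKernel_le hU hV hN hTL hTR hθ hθ' s
      y).trans ?_
    rw [← ENNReal.ofReal_mul (Real.exp_pos _).le]
    refine ENNReal.ofReal_le_ofReal (mul_le_mul_of_nonneg_right ?_ (Real.exp_pos _).le)
    refine Real.exp_le_exp.2 (mul_le_mul_of_nonneg_left hsle ?_)
    have := hTL.le; have := hTR.le
    positivity
  calc ∫⁻ y, ENNReal.ofReal (Real.exp (θ * H y)) ∂(κ tstar z)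
      = ∫⁻ y, ∫⁻ y', ENNReal.ofReal (Real.exp (θ * H y')) ∂(κ s y) ∂(κ w z) := e1
    _ ≤ ∫⁻ y, ENNReal.ofReal (Real.exp (θ * P.γ * (T_L + T_R) * tstar)) *
          ENNReal.ofReal (Real.exp (θ * H y)) ∂(κ w z) := lintegral_mono fun y => e2 y
    _ = ENNReal.ofReal (Real.exp (θ * P.γ * (T_L + T_R) * tstar)) *
          ∫⁻ y, ENNReal.ofReal (Real.exp (θ * H y)) ∂(κ w z) := lintegral_const_mul _ hVm
    _ ≤ ENNReal.ofReal (Real.exp (θ * P.γ * (T_L + T_R) * tstar)) *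
          ENNReal.ofReal (κ₀ * Real.exp (θ * H z)) := by gcongr
    _ = ENNReal.ofReal (κ₀ * Real.exp (θ * P.γ * (T_L + T_R) * tstar) * Real.exp (θ * H z)) := by
        rw [← ENNReal.ofReal_mul (Real.exp_pos _).le]
        ring_nf
    _ ≤ ENNReal.ofReal (Real.exp (θ * H z) / 2) := by
        refine ENNReal.ofReal_le_ofReal ?_
        have h1 := mul_le_mul_of_nonneg_right hκ (Real.exp_pos (θ * H z)).le
        linarith

/-- **The window estimate from a pathwise energy drop** (in place of CEHR Lemma 5.5): if on the
event `{sup_{s≤w}|B¹_s| ≤ a, sup_{s≤w}|B²_s| ≤ a}` of the pair of bath Brownian motions the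
pathwise solution `Φ_w(z, B) = langevinSolMap … w z (pairPath B)` loses at least `D/θ` of energy,
then `P_w e^{θH}(z) ≤ e^{θH(z)} (e^{-D} + e^{θγ(T_L+T_R)w} P(bad)^{1-1/p})` for any `p > 1` with
`pθ < 1/max(T_L,T_R)`: split the expectation `E e^{θH(Φ_w(z,B))}` (`lintegral_langevinKernel`)
according to the event; on the bad event use Hölder's inequality and (3.4) at `pθ`.
[cite: CuneoEckmannHairerReyBellet2018, Lemma 5.5 and §3 eq. (3.4)] -/
theorem window_decay_of_pathwise (hP : P.IsConfining) (hU : ContDiff ℝ ∞ P.U)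
    (hV : ContDiff ℝ ∞ P.V) (hN : 0 < N) (hTL : 0 < T_L) (hTR : 0 < T_R) {θ : ℝ} (hθ : 0 < θ) {p : ℝ} (hp : 1 < p)
    (hpθ : p * θ < 1 / max T_L T_R) (w : ℝ≥0) (a D : ℝ) (z : PhaseSpace N)
    (hgood : ∀ ξ ∈ goodEvent a w,
      θ * P.hamiltonian N (P.langevinSolMap N T_L T_R w z (pairPath ξ)) ≤
        θ * P.hamiltonian N z - D) :
    ∫⁻ y, ENNReal.ofReal (Real.exp (θ * P.hamiltonian N y)) ∂(P.langevinKernel N T_L T_R w z) ≤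
      ENNReal.ofReal (Real.exp (θ * P.hamiltonian N z)) *
        (ENNReal.ofReal (Real.exp (-D)) +
          ENNReal.ofReal (Real.exp (θ * P.γ * (T_L + T_R) * w)) *
            (wienerPair (goodEvent a w)ᶜ) ^ (1 - p⁻¹)) := by
  set H := P.hamiltonian N with hH
  set κ := P.langevinKernel N T_L T_R with hκ'
  set Φ : WienerPair → PhaseSpace N := fun ξ => P.langevinSolMap N T_L T_R w z (pairPath ξ) with hΦ
  set G := goodEvent a w with hG
  have hGm : MeasurableSet G := measurableSet_goodEvent a w
  have hp0 : (0 : ℝ) < p := by linarith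
  have hθp : 0 < p * θ := mul_pos hp0 hθ
  have hγ0 : 0 ≤ P.γ := hP.γ_nonneg
  have hVm : ∀ θ' : ℝ, Measurable fun y : PhaseSpace N => ENNReal.ofReal (Real.exp (θ' * H y)) :=
    fun θ' => ENNReal.measurable_ofReal.comp (Real.measurable_exp.comp
      (measurable_const.mul (hP.differentiable_hamiltonian N).continuous.measurable))
  have hΦm : Measurable Φ := hP.measurable_langevinSolMap_pairPath_right N T_L T_R w z
  set f : WienerPair → ℝ≥0∞ := fun ξ => ENNReal.ofReal (Real.exp (θ * H (Φ ξ))) with hf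
  have hfm : Measurable f := (hVm θ).comp hΦm
  -- pathwise representation of `P_w e^{θH}(z)`
  have e0 : ∫⁻ y, ENNReal.ofReal (Real.exp (θ * H y)) ∂(κ w z) = ∫⁻ ξ, f ξ ∂wienerPair :=
    hP.lintegral_langevinKernel N T_L T_R w z (hVm θ)
  -- the good event: the pathwise energy drop
  have e1 : ∫⁻ ξ in G, f ξ ∂wienerPair ≤
      ENNReal.ofReal (Real.exp (θ * H z)) * ENNReal.ofReal (Real.exp (-D)) := by
    calc ∫⁻ ξ in G, f ξ ∂wienerPair
        ≤ ∫⁻ _ in G, ENNReal.ofReal (Real.exp (θ * H z)) * ENNReal.ofReal (Real.exp (-D))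
            ∂wienerPair := by
          refine setLIntegral_mono' hGm fun ξ hξ => ?_
          show ENNReal.ofReal (Real.exp (θ * H (Φ ξ))) ≤ _
          rw [← ENNReal.ofReal_mul (Real.exp_pos _).le, ← Real.exp_add]
          exact ENNReal.ofReal_le_ofReal (Real.exp_le_exp.2 (by linarith [hgood ξ hξ]))
      _ = ENNReal.ofReal (Real.exp (θ * H z)) * ENNReal.ofReal (Real.exp (-D)) * wienerPair G :=
          setLIntegral_const _ _
      _ ≤ ENNReal.ofReal (Real.exp (θ * H z)) * ENNReal.ofReal (Real.exp (-D)) * 1 := by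
          gcongr
          exact prob_le_one
      _ = _ := mul_one _
  -- the bad event: Hölder with exponents `p`, `p/(p-1)` and (3.4) at `pθ`
  have e2 : ∫⁻ ξ in Gᶜ, f ξ ∂wienerPair ≤
      ENNReal.ofReal (Real.exp (θ * H z)) * (ENNReal.ofReal (Real.exp (θ * P.γ * (T_L + T_R) * w)) *
        (wienerPair Gᶜ) ^ (1 - p⁻¹)) := by
    have hpq : p.HolderConjugate (Real.conjExponent p) := Real.HolderConjugate.conjExponent hp
    set g : WienerPair → ℝ≥0∞ := Gᶜ.indicator 1 with hg
    have hgm : Measurable g := measurable_one.indicator hGm.compl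
    have e21 : ∫⁻ ξ in Gᶜ, f ξ ∂wienerPair = ∫⁻ ξ, (f * g) ξ ∂wienerPair := by
      rw [← lintegral_indicator hGm.compl]
      refine lintegral_congr fun ξ => ?_
      by_cases hξ : ξ ∈ Gᶜ
      · rw [Set.indicator_of_mem hξ, Pi.mul_apply, hg, Set.indicator_of_mem hξ, Pi.one_apply, mul_one]
      · rw [Set.indicator_of_notMem hξ, Pi.mul_apply, hg, Set.indicator_of_notMem hξ, mul_zero]
    have e22 := ENNReal.lintegral_mul_le_Lp_mul_Lq wienerPair hpq hfm.aemeasurable hgm.aemeasurable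
    have e23 : ∫⁻ ξ, f ξ ^ p ∂wienerPair ≤
        ENNReal.ofReal (Real.exp (p * θ * P.γ * (T_L + T_R) * w) * Real.exp (p * θ * H z)) := by
      have h1 : ∀ ξ, f ξ ^ p = ENNReal.ofReal (Real.exp (p * θ * H (Φ ξ))) := fun ξ => by
        show ENNReal.ofReal (Real.exp (θ * H (Φ ξ))) ^ p = _
        rw [ENNReal.ofReal_rpow_of_pos (Real.exp_pos _), ← Real.exp_mul]
        congr 2
        ring
      simp_rw [h1]
      rw [← hP.lintegral_langevinKernel N T_L T_R w z (hVm (p * θ))]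
      exact hP.lintegral_exp_mul_hamiltonian_langevinKernel_le hU hV hN hTL hTR hθp hpθ w z
    have e24 : (∫⁻ ξ, f ξ ^ p ∂wienerPair) ^ (1 / p) ≤
        ENNReal.ofReal (Real.exp (θ * P.γ * (T_L + T_R) * w) * Real.exp (θ * H z)) := by
      refine (ENNReal.rpow_le_rpow e23 (by positivity)).trans (le_of_eq ?_)
      have h2 : (Real.exp (p * θ * P.γ * (T_L + T_R) * w) * Real.exp (p * θ * H z)) ^ (1 / p) =
          Real.exp (θ * P.γ * (T_L + T_R) * w) * Real.exp (θ * H z) := by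
        rw [← Real.exp_add, ← Real.exp_add, ← Real.exp_mul]
        congr 1
        field_simp
      rw [ENNReal.ofReal_rpow_of_nonneg (by positivity) (by positivity), h2]
    have e25 : ∫⁻ ξ, g ξ ^ Real.conjExponent p ∂wienerPair = wienerPair Gᶜ := by
      have hq : 0 < Real.conjExponent p := hpq.symm.pos
      have h1 : ∀ ξ, g ξ ^ Real.conjExponent p = g ξ := fun ξ => by
        by_cases hξ : ξ ∈ Gᶜ
        · rw [hg, Set.indicator_of_mem hξ, Pi.one_apply, ENNReal.one_rpow]
        · rw [hg, Set.indicator_of_notMem hξ, ENNReal.zero_rpow_of_pos hq]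
      simp_rw [h1, hg]
      exact lintegral_indicator_one hGm.compl
    have e26 : 1 / Real.conjExponent p = 1 - p⁻¹ := by
      simp only [Real.conjExponent]
      have : p - 1 ≠ 0 := by linarith
      field_simp
    calc ∫⁻ ξ in Gᶜ, f ξ ∂wienerPair = ∫⁻ ξ, (f * g) ξ ∂wienerPair := e21
      _ ≤ (∫⁻ ξ, f ξ ^ p ∂wienerPair) ^ (1 / p) *
            (∫⁻ ξ, g ξ ^ Real.conjExponent p ∂wienerPair) ^ (1 / Real.conjExponent p) := e22
      _ ≤ ENNReal.ofReal (Real.exp (θ * P.γ * (T_L + T_R) * w) * Real.exp (θ * H z)) *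
            (wienerPair Gᶜ) ^ (1 - p⁻¹) := by
          rw [e25, e26]
          gcongr
      _ = _ := by
          rw [ENNReal.ofReal_mul (Real.exp_pos _).le]
          ring
  rw [e0, ← lintegral_add_compl f hGm, mul_add]
  exact add_le_add e1 e2

end OscillatorChain.IsConfining

end Literature.MathematicalPhysics.KineticTheory.HeatConduction
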